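import Summits.BirchSwinnertonDyer.Rank1Residual.X5.TwoAdicTargets
import Summits.BirchSwinnertonDyer.Rank1Residual.X1.MuLambdaAlgebra
import Literature.NumberTheory.EllipticCurves.PAdicLFunctionNeZeroHoldsProofs
import Literature.NumberTheory.EllipticCurves.CyclotomicIwasawaMainTheoremIrreducibleProofs
import HarnessLib

/-!
# Class O1 (X5, `p = 2`, non-CM): the E2 target `KatoDivisibilityAtTwoUpTo W k f` IS a μ-inequality
# (`MuGapAtTwo`, o1 lead PLAN v2.1 C19 / v2.2 C25b, made kernel-precise)

HONEST FRAMING (cell `b2b-bsdres`, run/shared/lean/b2b/bsd-rank1-residual/, verbatim in every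
file): the goal of the cell is to DELETE the COMBINATION-SHAPED residual classes of the
Birch–Swinnerton-Dyer formula for ALL analytic-rank `≤ 1` elliptic curves over `ℚ` — "full BSD
formula for every rank `≤ 1` curve in class `C`" assembled STRICTLY from published theorems — so
that the rank-`≤ 1` remainder becomes exactly the CONSTRUCTION-SHAPED classes, which are TYPED
(missing-input `Prop`s), NOT attempted. This is not "finishing BSD". Research routes; no claim
beyond stated classes; census output = EVIDENCE, never a Literature fact; nothing here is booked;
no mark of RESIDUAL-MAP §I moves.

Unit `b2b-bsdres-cc-typer-4` (lane CLASS-CLOSURE, class O1), gen 2, thirteenth file of the O1 typer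
folder: the optional typing ask `MuGapAtTwo` of the o1 class lead (PLAN v2.1 §9.2 item 4 "lead: YES";
v2.2 C25b: "Λ = ℤ₂⟦T⟧ is a UFD with 2 prime, so given Kato 17.4(2)@2 [PUB] (char X ∋ g₀,
ι g₀ = 2^a L₂) one has f_X ∣ 2ⁿL₂ ⟺ μ₂(X) ≤ n + μ(L₂) … the crux at level k on O1-A-go reads 'Kato's
divisibility at 2 with 2-power loss k ⟹ μ₂(X) ≤ k'") — PROVED, with no new definition: the
μ-invariant of an element of `Λ` is the x1 lineage's `X1.MuLambda.mu` (`X1/MuLambdaAlgebra.lean`: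
`g = p^{μ(g)} · pfree g`, `pfree g ≢ 0 (mod p)`, `μ` additive). THEOREMS ONLY.

* §1 (pure algebra of `Λ = ℤ_p⟦T⟧`, any `p`): `mu_C_pow_mul` (`μ(pⁿ g) = n + μ(g)`) and
  **`dvd_C_pow_mul_iff_mu_le`**: for nonzero `f, G ∈ Λ` with `f ∣ p^m G` for SOME `m`, and every `n`,
  `f ∣ pⁿ G ⟺ μ(f) ≤ n + μ(G)` — because `p` is prime in `Λ` (uniqueness of `g = p^a g₀`,
  `X1.MuLambda.eq_of_C_pow_mul_eq`) the `p`-free parts satisfy `pfree f ∣ pfree G` as soon as one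
  divisibility holds, and then only the `p`-powers matter. No Weierstrass preparation is needed.
* §2 (O1): **`katoDivisibilityAtTwoUpTo_iff_muGap`** — granted Kato 17.4 (1)(2) AT `2` (IN PRINT,
  parity-free; the tree's named fact `kato_divisibility_allPrimes W 2`, which supplies "`X` torsion and
  `2^m · L₂ ∈ ι(char_Λ X)` for some `m`") and T-INT2's integral `L₂` (`ι G = L₂(f, α)`, a THEOREM on the
  `E[2]`-irreducible good-ordinary locus: `exists_iwasawaToPowerSeries_eq_padicLFunction_two`,
  `PAdicLFunctionIntegralityAtTwoProofs`), the E2 target reads: for every cyclotomic datum, dual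
  datum `D` and generator `f_X` of `char_Λ X(E/ℚ_∞)`, **`μ(f_X) ≤ k + μ(G)`** — "Kato's divisibility at
  `2` with `2`-power loss `k`" IS "the μ-gap `μ₂(X) − μ₂(L₂)` is at most `k`". With lens-1's EVIDENCE
  `μ₂(ϖL₂) = 0` on irreducible rows (P2a; not used here) the per-row closing condition of the
  END-STATE (`k ≤ 1`, `X5/TwoAdicTargetsEndState*.lean`) is `μ₂(X) ≤ 1`; the main conjecture at `2`
  predicts `μ₂(X) = μ₂(L₂)` (Greenberg Conj. 1.11 at `2`: both `0` on irreducible `E[2]`), OPEN.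

Nothing is booked; no statement about any curve's `μ₂(X)` is asserted.

References: [Kato2004Asterisque] Thm. 17.4 (1)(2) (p. 273); [GreenbergVatsal2000] (1)–(2) p. 4;
[Washington1997] §7.1, §13.2; [GreenbergLNM1716] Conj. 1.11.
-/

set_option autoImplicit false

noncomputable section

open scoped Classical MatrixGroups ModularForm

open CongruenceSubgroup WeierstrassCurve Literature.NumberTheory.EllipticCurves
  Literature.NumberTheory.EllipticCurves.ModularForms
  Literature.NumberTheory.EllipticCurves.Rank1Residual
  Literature.NumberTheory.EllipticCurves.Rank1Residual.Typed
  Summit.BirchSwinnertonDyer.Rank1Residual.X1.MuLambda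

namespace Summit.BirchSwinnertonDyer.Rank1Residual.X5.O1

/-! ## §1 `f ∣ pⁿ G ⟺ μ(f) ≤ n + μ(G)` once some `f ∣ p^m G` holds -/

section Algebra

variable {p : ℕ} [Fact p.Prime]

/-- `μ(pⁿ · g) = n + μ(g)` for `g ≠ 0` (`pⁿ g = p^{n+μ(g)} · pfree g`, uniqueness of the
decomposition). [cite: GreenbergVatsal2000, p. 4, (2) (definition of μ)] -/
theorem mu_C_pow_mul {g : IwasawaAlgebra p} (hg : g ≠ 0) (n : ℕ) :
    mu (PowerSeries.C ((p : ℤ_[p]) ^ n) * g) = n + mu g := by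
  have hfac : PowerSeries.C ((p : ℤ_[p]) ^ n) * g =
      PowerSeries.C ((p : ℤ_[p]) ^ (n + mu g)) * pfree g := by
    conv_lhs => rw [eq_C_pow_mu_mul_pfree g]
    rw [pow_add, map_mul, mul_assoc]
  exact (mu_eq_and_pfree_eq (red_pfree_ne_zero hg) hfac).1

/-- **The μ-gap criterion.** For nonzero `f, G ∈ Λ = ℤ_p⟦T⟧` such that `f ∣ p^m · G` for SOME `m`:
for every `n`, `f ∣ pⁿ · G ⟺ μ(f) ≤ n + μ(G)`. (→): `μ` is monotone under divisibility and
`μ(pⁿG) = n + μ(G)`. (←): from `p^m G = f h` and the unique decompositions `x = p^{μ(x)} · pfree x`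
(`p` prime in `Λ`: `eq_of_C_pow_mul_eq`), `pfree G = pfree f · pfree h`; hence
`pⁿ G = p^{n+μ(G)} pfree f · pfree h = f · (p^{n+μ(G)−μ(f)} pfree h)` when `μ(f) ≤ n + μ(G)`.
[cite: Washington1997, §7.1 (Λ/pΛ = 𝔽_p⟦T⟧ a domain; p prime in Λ)] -/
theorem dvd_C_pow_mul_iff_mu_le {f G : IwasawaAlgebra p} (hf : f ≠ 0) (hG : G ≠ 0) {m : ℕ}
    (hm : f ∣ PowerSeries.C ((p : ℤ_[p]) ^ m) * G) (n : ℕ) :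
    f ∣ PowerSeries.C ((p : ℤ_[p]) ^ n) * G ↔ mu f ≤ n + mu G := by
  constructor
  · rintro ⟨h, hh⟩
    have hne : PowerSeries.C ((p : ℤ_[p]) ^ n) * G ≠ 0 := mul_ne_zero (C_pow_ne_zero n) hG
    have hh0 : h ≠ 0 := by
      rintro rfl
      exact hne (by rw [hh, mul_zero])
    have hle := mu_le_mu_mul hf hh0
    rwa [← hh, mu_C_pow_mul hG] at hle
  · intro hle
    obtain ⟨h, hh⟩ := hm
    have hne : PowerSeries.C ((p : ℤ_[p]) ^ m) * G ≠ 0 := mul_ne_zero (C_pow_ne_zero m) hG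
    have hh0 : h ≠ 0 := by
      rintro rfl
      exact hne (by rw [hh, mul_zero])
    have key : PowerSeries.C ((p : ℤ_[p]) ^ (m + mu G)) * pfree G =
        PowerSeries.C ((p : ℤ_[p]) ^ (mu f + mu h)) * (pfree f * pfree h) := by
      calc PowerSeries.C ((p : ℤ_[p]) ^ (m + mu G)) * pfree G
          = PowerSeries.C ((p : ℤ_[p]) ^ m) * G := by
            conv_rhs => rw [eq_C_pow_mu_mul_pfree G]
            rw [pow_add, map_mul, mul_assoc]
        _ = f * h := hh
        _ = PowerSeries.C ((p : ℤ_[p]) ^ (mu f + mu h)) * (pfree f * pfree h) := by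
            conv_lhs => rw [eq_C_pow_mu_mul_pfree f, eq_C_pow_mu_mul_pfree h]
            rw [pow_add, map_mul]; ring
    have hred : red (pfree f * pfree h) ≠ 0 := by
      rw [red, map_mul]
      exact mul_ne_zero (red_pfree_ne_zero hf) (red_pfree_ne_zero hh0)
    obtain ⟨-, hpf⟩ := eq_of_C_pow_mul_eq (red_pfree_ne_zero hG) hred key
    obtain ⟨d, hd⟩ := Nat.exists_eq_add_of_le hle
    refine ⟨PowerSeries.C ((p : ℤ_[p]) ^ d) * pfree h, ?_⟩
    calc PowerSeries.C ((p : ℤ_[p]) ^ n) * G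
        = PowerSeries.C ((p : ℤ_[p]) ^ (n + mu G)) * pfree G := by
          conv_lhs => rw [eq_C_pow_mu_mul_pfree G]
          rw [pow_add, map_mul, mul_assoc]
      _ = PowerSeries.C ((p : ℤ_[p]) ^ (mu f + d)) * (pfree f * pfree h) := by rw [hd, hpf]
      _ = (PowerSeries.C ((p : ℤ_[p]) ^ mu f) * pfree f) *
            (PowerSeries.C ((p : ℤ_[p]) ^ d) * pfree h) := by rw [pow_add, map_mul]; ring
      _ = f * (PowerSeries.C ((p : ℤ_[p]) ^ d) * pfree h) := by rw [← eq_C_pow_mu_mul_pfree f]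

/-- Monotonicity in the exponent: `f ∣ pⁿ G → f ∣ p^{n'} G` for `n ≤ n'`. [folklore] -/
theorem dvd_C_pow_mul_mono {f G : IwasawaAlgebra p} {n n' : ℕ} (hnn : n ≤ n')
    (h : f ∣ PowerSeries.C ((p : ℤ_[p]) ^ n) * G) :
    f ∣ PowerSeries.C ((p : ℤ_[p]) ^ n') * G := by
  obtain ⟨d, rfl⟩ := Nat.exists_eq_add_of_le hnn
  rw [add_comm, pow_add, map_mul, mul_assoc]
  exact Dvd.dvd.mul_left h _

end Algebra

/-! ## §2 The E2 target at `2` is the μ-gap inequality -/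

variable (W : WeierstrassCurve ℚ) [W.IsElliptic] [W.IsGloballyMinimal]

omit [W.IsElliptic] [W.IsGloballyMinimal] in
/-- A generator of `char_Λ X` is non-zero (`char_Λ` of any module over a domain is a non-zero
ideal, `Module.charIdeal_ne_bot`). [folklore] -/
private theorem generator_ne_zero {κ : ZpExtension ℚ 2} {γ : Field.absoluteGaloisGroup ℚ}
    (D : W.SelmerDualData κ γ) {fE : IwasawaAlgebra 2} (hchar : D.charIdeal = Ideal.span {fE}) :
    fE ≠ 0 := by
  intro h0
  refine Module.charIdeal_ne_bot (IwasawaAlgebra 2) D.X ?_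
  change D.charIdeal = ⊥
  rw [hchar, h0]
  exact Ideal.span_singleton_eq_bot.mpr rfl

omit [W.IsElliptic] in
/-- With `ι G = L₂`: "`ι g = 2ⁿ · L₂` for some `g ∈ (f_X)`" ⟺ "`f_X ∣ 2ⁿ · G` in `Λ`" (`ι` injective,
`iwasawaToPowerSeries_injective`). [cite: MazurTateTeitelbaum1986Invent, §I.12 (Λ ↪ ℚ_p⟦T⟧)] -/
theorem exists_mem_span_iff_dvd {N : ℕ} [NeZero N] {f : CuspForm (Gamma0 N) 2}
    {G : IwasawaAlgebra 2}
    (hG : iwasawaToPowerSeries 2 G = padicLFunction f (unitRoot W 2 : ℚ_[2]))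
    (fE : IwasawaAlgebra 2) (n : ℕ) :
    (∃ g ∈ Ideal.span {fE}, iwasawaToPowerSeries 2 g =
        PowerSeries.C ((2 : ℚ_[2]) ^ n) * padicLFunction f (unitRoot W 2 : ℚ_[2])) ↔
      fE ∣ PowerSeries.C (((2 : ℕ) : ℤ_[2]) ^ n) * G := by
  have hι : iwasawaToPowerSeries 2 (PowerSeries.C (((2 : ℕ) : ℤ_[2]) ^ n) * G) =
      PowerSeries.C ((2 : ℚ_[2]) ^ n) * padicLFunction f (unitRoot W 2 : ℚ_[2]) := by
    rw [map_mul, hG]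
    congr 1
    rw [show iwasawaToPowerSeries 2 (PowerSeries.C (((2 : ℕ) : ℤ_[2]) ^ n)) =
      PowerSeries.map (PadicInt.Coe.ringHom (p := 2)) (PowerSeries.C (((2 : ℕ) : ℤ_[2]) ^ n))
      from rfl, PowerSeries.map_C, map_pow, map_natCast, Nat.cast_ofNat]
  constructor
  · rintro ⟨g, hg, hιg⟩
    have heq : g = PowerSeries.C (((2 : ℕ) : ℤ_[2]) ^ n) * G :=
      iwasawaToPowerSeries_injective 2 (hιg.trans hι.symm)
    rw [← Ideal.mem_span_singleton, ← heq]
    exact hg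
  · intro h
    exact ⟨_, Ideal.mem_span_singleton.mpr h, hι⟩

/-- **`KatoDivisibilityAtTwoUpTo W k f` IS the μ-gap inequality `μ(f_X) ≤ k + μ(L₂)`.** Granted
Kato's Theorem 17.4 (1)(2) AT `2` (the parity-free named fact `kato_divisibility_allPrimes W 2`: `X`
torsion and `char_Λ X ∋ g₀` with `ι g₀ = 2^m · L₂` for SOME `m`) and an integral `2`-adic
`L`-function `G ∈ Λ` with `ι G = L₂(f, α)` (T-INT2, a theorem on the `E[2]`-irreducible good-ordinary
locus), the E2 target at level `k` holds iff for every cyclotomic datum, every dual datum `D` and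
every generator `f_X` of `char_Λ X(E/ℚ_∞)`: `μ(f_X) ≤ k + μ(G)` (`μ` = `X1.MuLambda.mu`, the exact
power of `2` dividing an element of `Λ = ℤ₂⟦T⟧`). So a proof of Kato's divisibility at `2` with
`2`-power loss `k` is EXACTLY a certificate `μ₂(X) ≤ μ₂(L₂) + k`, and the END-STATE's `k ≤ 1`
(`X5/TwoAdicTargetsEndState.lean`) asks for a μ-gap of at most one. OPEN; nothing about any curve's
`μ₂(X)` is asserted. [cite: Kato2004Asterisque, Thm. 17.4 (1)(2) (p. 273)]
[cite: GreenbergVatsal2000, p. 4, (1)–(2)] -/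
theorem katoDivisibilityAtTwoUpTo_iff_muGap (k : ℕ) {N : ℕ} [NeZero N]
    (f : CuspForm (Gamma0 N) 2) {G : IwasawaAlgebra 2}
    (hG : iwasawaToPowerSeries 2 G = padicLFunction f (unitRoot W 2 : ℚ_[2]))
    (hKin : kato_divisibility_allPrimes W 2 (f := f)) :
    KatoDivisibilityAtTwoUpTo W k f ↔
      ∀ (κ : ZpExtension ℚ 2) (γ : Field.absoluteGaloisGroup ℚ), κ.IsCyclotomic →
        κ.IsTopGenerator γ → IsCyclotomicVariable 2 γ → IsOrdinaryAt W 2 → IsNewformOf W f →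
        TwoAdicSurjective W →
        ∀ (D : W.SelmerDualData κ γ) (fE : IwasawaAlgebra 2), D.charIdeal = Ideal.span {fE} →
          mu fE ≤ k + mu G := by
  constructor
  · intro h κ γ hκ hγ hγ' hord hf him D fE hchar
    obtain ⟨-, n, g, hnk, hg, hι⟩ := h κ γ hκ hγ hγ' hord hf him D
    have hfE : fE ≠ 0 := generator_ne_zero W D hchar
    have hL : padicLFunction f (unitRoot W 2 : ℚ_[2]) ≠ 0 := padicLFunction_ne_zero_holds hord hf
    have hG0 : G ≠ 0 := by
      rintro rfl
      exact hL (by rw [← hG, map_zero])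
    rw [hchar] at hg
    have hdvd : fE ∣ PowerSeries.C (((2 : ℕ) : ℤ_[2]) ^ n) * G :=
      (exists_mem_span_iff_dvd W hG fE n).1 ⟨g, hg, hι⟩
    have hle := (dvd_C_pow_mul_iff_mu_le hfE hG0 hdvd n).1 hdvd
    omega
  · intro h κ γ hκ hγ hγ' hord hf him D
    obtain ⟨htor, m, g, hg, hι⟩ := hKin κ γ hκ hγ hγ' hord hf D
    haveI : (Module.charIdeal (IwasawaAlgebra 2) D.X).IsPrincipal := charIdeal_isPrincipal_holds 2 D.X
    obtain ⟨fE, hchar⟩ := Submodule.IsPrincipal.principal (Module.charIdeal (IwasawaAlgebra 2) D.X)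
    have hchar' : D.charIdeal = Ideal.span {fE} := hchar
    have hfE : fE ≠ 0 := generator_ne_zero W D hchar'
    have hL : padicLFunction f (unitRoot W 2 : ℚ_[2]) ≠ 0 := padicLFunction_ne_zero_holds hord hf
    have hG0 : G ≠ 0 := by
      rintro rfl
      exact hL (by rw [← hG, map_zero])
    rw [hchar'] at hg
    have hm : fE ∣ PowerSeries.C (((2 : ℕ) : ℤ_[2]) ^ m) * G :=
      (exists_mem_span_iff_dvd W hG fE m).1 ⟨g, hg, hι⟩
    have hk : fE ∣ PowerSeries.C (((2 : ℕ) : ℤ_[2]) ^ k) * G :=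
      (dvd_C_pow_mul_iff_mu_le hfE hG0 hm k).2 (h κ γ hκ hγ hγ' hord hf him D fE hchar')
    obtain ⟨g', hg', hι'⟩ : ∃ g ∈ Ideal.span {fE}, iwasawaToPowerSeries 2 g =
        PowerSeries.C ((2 : ℚ_[2]) ^ k) * padicLFunction f (unitRoot W 2 : ℚ_[2]) :=
      (exists_mem_span_iff_dvd W hG fE k).2 hk
    refine ⟨htor, k, g', le_rfl, ?_, hι'⟩
    rw [hchar']
    exact hg'

/-- **Corollary (the printed half is free): Kato 17.4 (1)(2) at `2` + T-INT2 give the E2 target at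
level `k = μ(f_X) − μ(G)` for each datum** — i.e. the only content of `KatoDivisibilityAtTwoUpTo W k f`
beyond print is the UNIFORM bound `k`. Recorded as: if every generator has `μ(f_X) ≤ k + μ(G)`, the
target holds (one direction of `katoDivisibilityAtTwoUpTo_iff_muGap`, restated for citation).
[cite: Kato2004Asterisque, Thm. 17.4 (1)(2) (p. 273)] -/
theorem katoDivisibilityAtTwoUpTo_of_muGap (k : ℕ) {N : ℕ} [NeZero N]
    (f : CuspForm (Gamma0 N) 2) {G : IwasawaAlgebra 2}
    (hG : iwasawaToPowerSeries 2 G = padicLFunction f (unitRoot W 2 : ℚ_[2]))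
    (hKin : kato_divisibility_allPrimes W 2 (f := f))
    (h : ∀ (κ : ZpExtension ℚ 2) (γ : Field.absoluteGaloisGroup ℚ), κ.IsTopGenerator γ →
      ∀ (D : W.SelmerDualData κ γ) (fE : IwasawaAlgebra 2), D.charIdeal = Ideal.span {fE} →
        mu fE ≤ k + mu G) :
    KatoDivisibilityAtTwoUpTo W k f :=
  (katoDivisibilityAtTwoUpTo_iff_muGap W k f hG hKin).2
    fun κ γ _ hγ _ _ _ _ D fE hchar ↦ h κ γ hγ D fE hchar

end Summit.BirchSwinnertonDyer.Rank1Residual.X5.O1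

end
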